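import Summits.AtomisticToContinuum.BoseEinsteinCondensation.Theses.BECInsertionVariance
import HarnessLib.Audit

/-!
# Birth skeleton for crux `BECInsertionVariance.OneBodyLogHarnack`
(item stmt-AtomisticToContinuum-12066, route route-AtomisticToContinuum-BECInsertionVariance, rank 4;
skeleton registrar planner-skel-stmt-AtomisticToContinuum-12066-0, 2026-08-17; published as
`Cruxes/OneBodyLogHarnack/Lines/birth.lean`)

Crux (FIXED, concluded BY NAME below): for admissible `v` and `0 < ρ < ρ₀(v)` there is `C` with,
eventually in `N = n + 1`, `Ψ₀ = groundState v N L` (`L = (N/ρ)^(1/3)`), `r = (ρa)^(-1/2)`,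
`B = ball 0 r`, `Φ(X, h) = Ψ₀(X with x₀ ↦ x₀ + h)`:
 (a) `∫⁻_{h ∈ B, Φ = 0} Ψ₀(X)² ≤ |B|/4` (inaccessible displaced mass) and
 (b) `∫⁻_{h ∈ B, Φ ≠ 0} |log Ψ₀(X)² − log Φ²| Ψ₀(X)² ≤ C |B|` (accessible log-oscillation, first moment).

## The three stubs (genuine lemmas of the line; sorries live ONLY here)

* `stub_wallLayer` (size M/L) — NO ACCUMULATION AT THE DIRICHLET WALL AT THE HEALING SCALE: the
  `Ψ₀²`-mass of configurations whose tagged particle, displaced by `h ∈ B`, LEAVES the open box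
  `Λ_L` is `≤ |B|/8` eventually. Equivalently a bound on the one-body density of `Ψ₀` in the wall
  layer of thickness `r`: its occupation fraction is `≲ 6 C r / L → 0` given a local density bound
  `ρ_Ψ₀ ≤ Cρ` uniform in `N` (not in print for the interacting Dirichlet ground state; kinetic-energy /
  Hardy arguments alone only give an `O(1)` fraction since `r⁻² = ρa` is the energy scale).
* `stub_coreContact` (size M) — CONTACT WITH THE INTERIOR ZERO SET: displaced INTO the box but onto
  `{Ψ₀ = 0}` (hard cores / hard shells: `x₀ + h` inside a core of some `x_j`) has mass `≤ |B|/8`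
  eventually. For locally bounded `v` the integral is `0` (a.e. positivity of `Ψ₀` on the box — in tree
  for bounded `v`, `swapMass_groundState_eq_one_of_bounded` — transported by the measure-preserving
  shear `(X, h) ↦ (X^h, h)`); for hard cores it is a two-body contact-density bound uniform in `N`
  (the same missing input as the hard branch of `GroundStateAccessible`, stmt-12069).
* `stub_logMoment` (size L, the HEART) — JOHN–NIRENBERG / WEAK-HARNACK MOMENT FORM of the one-body
  log-Harnack property: for some order `s > 0` the two-sided power moment
  `∫⁻_{h ∈ B, Φ ≠ 0} ((Ψ₀²/Φ²)^s + (Φ²/Ψ₀²)^s) Ψ₀² ≤ C |B|` eventually, uniformly in `N`. Intended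
  proofs: Moser iteration + crossover lemma for the conditional one-variable amplitude
  `x ↦ Ψ₀(x, X̂)` (BMO of `log`, then exponential integrability), or ground-state-transformed
  diffusion of the tagged particle over time `r²` (GroundStateFeynmanKac layer) with Khasminskii.
  Strictly stronger than (b): `s |log x| ≤ x^s + x^(-s)` for `x > 0` (proved below).

## Composition (kernel-checked, no sorry)

`OneBodyLogHarnack_of (hW : __Registered.stub_wallLayer) (hC : __Registered.stub_coreContact)
(hM : __Registered.stub_logMoment) : Theses.BECInsertionVariance.OneBodyLogHarnack` — the three stub
STATEMENTS (name-keyed handles, definitionally the stubs) imply the crux BY NAME;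
`OneBodyLogHarnack_of_stubs : OneBodyLogHarnack` feeds the sorried stubs through it. Proof:
`ρ₀ := min` of the three thresholds, `C := C_M / s`; on the intersection of the three eventual sets,
(a) follows from `{Φ = 0} ⊆ {exit} ∪ {inside ∧ Φ = 0}`, `lintegral_union_le` and
`8⁻¹ + 8⁻¹ = 4⁻¹`; (b) from the pointwise `|log Ψ₀² − log Φ²| Ψ₀² ≤ s⁻¹ ((Ψ₀²/Φ²)^s + (Φ²/Ψ₀²)^s) Ψ₀²`
on `{Φ ≠ 0}` (junk-safe: the factor `Ψ₀²` kills the `Ψ₀ = 0` points, `Real.log 0 = 0` never bites),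
`setLIntegral_mono'` (the accessible set is measurable: `measurableSet_accessible`) and
`lintegral_const_mul'`.

## Disproof / negatives honoured

No `Disproof.lean` exists for this crux yet (no workfiles before this one). The refuter evidence on the
item (EVIDENCE.md / SUPERSINGULAR.md, 2026-08-15, informal, no Lean `¬`): for admissible SUPER-SINGULAR
soft cores `v = r^(-α)·1_(0,R₀]`, `α ≥ 8`, conjunct (b) is `+∞` at every `N ≥ 2` (WKB cusp
`−log Ψ₀ ≍ c·dist^(1−α/2)` non-integrable in `h`); the same witness hits `stub_logMoment` (and only it).
The proposed repair C′₁ (restrict to `v = ⊤ ∨ v ≤ K`) or C′₂ (quantile form) changes the HEAD of the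
crux only; all three stubs and the composition keep their shape verbatim under it.

## Audit expectations (BC3)

`lean check --json`: rc 0; sorries = 3 = stubs (`stub_wallLayer`, `stub_coreContact`,
`stub_logMoment`), zero elsewhere; `OneBodyLogHarnack_of` is sorry-free (axioms propext,
Classical.choice, Quot.sound) and concludes
`Summit.AtomisticToContinuum.BoseEinsteinCondensation.Theses.BECInsertionVariance.OneBodyLogHarnack` by name.
Stub signatures are written `let`-free (the crux's `let L/Ψ₀/r/B/Φ` inlined) so that the registrar's
signature scan, which cuts at the first `:=`, records them whole; `dsimp only` zeta-reduces the crux to them.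
Probes (folder `bc/probe_*.lean`, NOT importing this file): `stub → OneBodyLogHarnack` and
`stub → BoseEinsteinCondensation` by `first | exact? | simpa | aesop` fail for all three stubs.
-/

noncomputable section

open MeasureTheory Filter Set Metric
open scoped ENNReal NNReal Topology

namespace Summit.AtomisticToContinuum.BoseEinsteinCondensation.Cruxes.OneBodyLogHarnack.Birth

open Literature.MathematicalPhysics.QuantumManyBody.BoseGas

/-! ### Registered stubs -/

/-- **Stub 1 — no accumulation at the Dirichlet wall at the healing scale (size M/L).**
For admissible `v` and small `ρ`, eventually in `N = n + 1`: with `Ψ₀ = groundState v N L`,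
`r = (ρa)^(-1/2)`, `B = ball 0 r`, the `Ψ₀² ⊗ Leb_B`-mass of the pairs `(X, h)` whose displaced tagged
particle `x₀ + h` lies OUTSIDE the open box `Λ_L` is at most `|B|/8`. (Vacuous when `a = 0` or
`a = ⊤`: `r = 0`, `B = ∅`; trivial in the junk branch `Ψ₀ = 0`.) Content: a one-body density bound for
the interacting Dirichlet ground state in the wall layer of thickness `r`, uniform along the
thermodynamic sequence (occupation fraction `≲ r/L → 0`). Leans on: `groundState`,
`groundState_eq_zero_of_not_mem`, `sideLength`; LSSY2005 Ch. 2–5 (Dyson/LY energy bounds do NOT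
suffice alone). -/
theorem stub_wallLayer :
      ∀ v : ℝ → ℝ≥0∞, IsRepulsiveFiniteRange v → ∃ ρ₀ : ℝ, 0 < ρ₀ ∧ ∀ ρ : ℝ, 0 < ρ → ρ < ρ₀ →
        ∀ᶠ n : ℕ in Filter.atTop,
          (∫⁻ W in {W : Config (n + 1) × Space | W.2 ∈ Metric.ball (0 : Space) (Real.sqrt (ρ * (scatteringLength v).toReal))⁻¹ ∧
                W.1 0 + W.2 ∉ box (sideLength ρ (n + 1))},
              ENNReal.ofReal (groundState v (n + 1) (sideLength ρ (n + 1)) W.1 ^ 2)) ≤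
            8⁻¹ * MeasureTheory.volume (Metric.ball (0 : Space) (Real.sqrt (ρ * (scatteringLength v).toReal))⁻¹) := by
  sorry

/-- **Stub 2 — contact with the interior zero set (size M).**
Same frame; the mass of the pairs `(X, h)`, `h ∈ B`, whose displaced tagged particle stays INSIDE
the box but lands on the zero set of `Ψ₀` (`Φ(X, h) = Ψ₀(X^h) = 0`: hard-core / hard-shell contact with
some `x_j`) is at most `|B|/8` eventually. For locally bounded `v` the integral vanishes (a.e.
positivity of `Ψ₀` on `Λ_L^N`, in tree for bounded `v`, transported by the measure-preserving shear
`(X, h) ↦ (X^h, h)`); for hard cores of diameter `a` it is a two-body contact-density bound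
`≲ ρ a³ · O(1)` uniform in `N`. Leans on: `swapMass_groundState_eq_one_of_bounded` (bounded branch),
`measurePreserving` shears; ReedSimonIV1978 XIII.47; LSSY2005. -/
theorem stub_coreContact :
      ∀ v : ℝ → ℝ≥0∞, IsRepulsiveFiniteRange v → ∃ ρ₀ : ℝ, 0 < ρ₀ ∧ ∀ ρ : ℝ, 0 < ρ → ρ < ρ₀ →
        ∀ᶠ n : ℕ in Filter.atTop,
          (∫⁻ W in {W : Config (n + 1) × Space | W.2 ∈ Metric.ball (0 : Space) (Real.sqrt (ρ * (scatteringLength v).toReal))⁻¹ ∧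
                W.1 0 + W.2 ∈ box (sideLength ρ (n + 1)) ∧ groundState v (n + 1) (sideLength ρ (n + 1)) (Function.update W.1 0 (W.1 0 + W.2)) = 0},
              ENNReal.ofReal (groundState v (n + 1) (sideLength ρ (n + 1)) W.1 ^ 2)) ≤
            8⁻¹ * MeasureTheory.volume (Metric.ball (0 : Space) (Real.sqrt (ρ * (scatteringLength v).toReal))⁻¹) := by
  sorry

/-- **Stub 3 — John–Nirenberg / weak-Harnack moment form of the one-body log-Harnack property
(size L, the heart of the crux).** Same frame; for some order `s > 0` and constant `C`, eventually in
`N`: `∫⁻_{h ∈ B, Φ ≠ 0} ((Ψ₀(X)²/Φ²)^s + (Φ²/Ψ₀(X)²)^s) Ψ₀(X)² d(X, h) ≤ C |B|` — a two-sided power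
moment of the displacement ratio `Ψ₀(X^h)²/Ψ₀(X)²` at the healing scale, `Ψ₀²`-typically. Intended
proof: Moser iteration + crossover (BMO of `log` of the conditional one-variable amplitude
`x ↦ Ψ₀(x, X̂)` with the frozen environment, then exponential integrability), or tagged-particle
ground-state diffusion over time `r²` with a Khasminskii bound; only the fluctuation of
`Σ_j u(x − x_j)` (variance `O(√(ρa³))`) and integrable core/wall power singularities enter.
Implies conjunct (b) with constant `C/s` via `s|log x| ≤ x^s + x^(-s)`. CAVEAT (item evidence
SUPERSINGULAR.md): false as typed for super-singular soft cores `v = r^(-α)1_(0,R₀]`, `α ≥ 8`, exactly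
like conjunct (b) of the crux itself; survives verbatim under the class repair C′₁.
Leans on: `groundState`, GroundStateFeynmanKac layer; ChungZhao1995, ReedSimonIV1978, Moser 1961. -/
theorem stub_logMoment :
      ∀ v : ℝ → ℝ≥0∞, IsRepulsiveFiniteRange v → ∃ ρ₀ : ℝ, 0 < ρ₀ ∧ ∀ ρ : ℝ, 0 < ρ → ρ < ρ₀ →
        ∃ s : ℝ, 0 < s ∧ ∃ C : ℝ, ∀ᶠ n : ℕ in Filter.atTop,
          (∫⁻ W in {W : Config (n + 1) × Space | W.2 ∈ Metric.ball (0 : Space) (Real.sqrt (ρ * (scatteringLength v).toReal))⁻¹ ∧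
                groundState v (n + 1) (sideLength ρ (n + 1)) (Function.update W.1 0 (W.1 0 + W.2)) ≠ 0},
              ENNReal.ofReal (((groundState v (n + 1) (sideLength ρ (n + 1)) W.1 ^ 2 / groundState v (n + 1) (sideLength ρ (n + 1)) (Function.update W.1 0 (W.1 0 + W.2)) ^ 2) ^ s +
                  (groundState v (n + 1) (sideLength ρ (n + 1)) (Function.update W.1 0 (W.1 0 + W.2)) ^ 2 / groundState v (n + 1) (sideLength ρ (n + 1)) W.1 ^ 2) ^ s) * groundState v (n + 1) (sideLength ρ (n + 1)) W.1 ^ 2)) ≤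
            ENNReal.ofReal C * MeasureTheory.volume (Metric.ball (0 : Space) (Real.sqrt (ρ * (scatteringLength v).toReal))⁻¹) := by
  sorry

/-! ### Glue lemmas (proved) -/

/-- `8⁻¹ + 8⁻¹ = 4⁻¹` in `ℝ≥0∞`. [folklore] -/
theorem inv_eight_add_inv_eight : (8 : ℝ≥0∞)⁻¹ + 8⁻¹ = 4⁻¹ := by
  apply (ENNReal.toReal_eq_toReal_iff' (by simp) (by simp)).mp
  rw [ENNReal.toReal_add (by simp) (by simp), ENNReal.toReal_inv, ENNReal.toReal_inv]
  norm_num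

/-- Union bound behind conjunct (a): if `S ⊆ S₁ ∪ S₂` and both pieces carry mass `≤ V/8`, then
`S` carries mass `≤ V/4`. [folklore] -/
theorem displacedMass_glue {α : Type*} [MeasurableSpace α] {μ : Measure α} {f : α → ℝ≥0∞}
    {S S₁ S₂ : Set α} {V : ℝ≥0∞}
    (h₁ : ∫⁻ x in S₁, f x ∂μ ≤ 8⁻¹ * V) (h₂ : ∫⁻ x in S₂, f x ∂μ ≤ 8⁻¹ * V) (hsub : S ⊆ S₁ ∪ S₂) :
    ∫⁻ x in S, f x ∂μ ≤ 4⁻¹ * V :=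
  calc ∫⁻ x in S, f x ∂μ ≤ ∫⁻ x in S₁ ∪ S₂, f x ∂μ := lintegral_mono_set hsub
    _ ≤ ∫⁻ x in S₁, f x ∂μ + ∫⁻ x in S₂, f x ∂μ := lintegral_union_le _ _ _
    _ ≤ 8⁻¹ * V + 8⁻¹ * V := add_le_add h₁ h₂
    _ = 4⁻¹ * V := by rw [← add_mul, inv_eight_add_inv_eight]

/-- The calculus inequality behind (b) ⇐ moment form: `|log x| ≤ s⁻¹ (x^s + x⁻¹^s)` for `x, s > 0`
(from `log y ≤ y − 1` at `y = x^s` and `y = x^(-s)`). [folklore] -/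
theorem abs_log_le_inv_mul_rpow_add {x s : ℝ} (hx : 0 < x) (hs : 0 < s) :
    |Real.log x| ≤ s⁻¹ * (x ^ s + x⁻¹ ^ s) := by
  have h1 : s * Real.log x ≤ x ^ s := by
    have h := Real.log_le_sub_one_of_pos (Real.rpow_pos_of_pos hx s)
    rw [Real.log_rpow hx] at h
    linarith [Real.rpow_nonneg hx.le s]
  have h2 : -(s * Real.log x) ≤ x⁻¹ ^ s := by
    have h := Real.log_le_sub_one_of_pos (Real.rpow_pos_of_pos (inv_pos.mpr hx) s)
    rw [Real.log_rpow (inv_pos.mpr hx), Real.log_inv] at h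
    linarith [Real.rpow_nonneg (inv_pos.mpr hx).le s]
  have key : s * |Real.log x| ≤ x ^ s + x⁻¹ ^ s := by
    rcases le_or_gt 0 (Real.log x) with h | h
    · rw [abs_of_nonneg h]
      linarith [Real.rpow_nonneg (inv_pos.mpr hx).le s]
    · rw [abs_of_neg h]
      linarith [Real.rpow_nonneg hx.le s]
  calc |Real.log x| ≤ (x ^ s + x⁻¹ ^ s) / s := (le_div_iff₀' hs).mpr key
    _ = s⁻¹ * (x ^ s + x⁻¹ ^ s) := div_eq_inv_mul _ _

/-- Pointwise form on the accessible set: for `b ≠ 0`,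
`ofReal (|log a² − log b²| a²) ≤ ofReal s⁻¹ * ofReal (((a²/b²)^s + (b²/a²)^s) a²)`; the point `a = 0`
is harmless because of the factor `a²`. [folklore] -/
theorem logOsc_integrand_le {a b s : ℝ} (hs : 0 < s) (hb : b ≠ 0) :
    ENNReal.ofReal (|Real.log (a ^ 2) - Real.log (b ^ 2)| * a ^ 2) ≤
      ENNReal.ofReal s⁻¹ *
        ENNReal.ofReal (((a ^ 2 / b ^ 2) ^ s + (b ^ 2 / a ^ 2) ^ s) * a ^ 2) := by
  rw [← ENNReal.ofReal_mul (inv_nonneg.mpr hs.le)]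
  apply ENNReal.ofReal_le_ofReal
  rcases eq_or_ne a 0 with ha | ha
  · subst ha
    simp
  · have ha2 : 0 < a ^ 2 := by positivity
    have hb2 : 0 < b ^ 2 := by positivity
    have hx : 0 < a ^ 2 / b ^ 2 := div_pos ha2 hb2
    rw [← Real.log_div ha2.ne' hb2.ne', ← mul_assoc]
    refine mul_le_mul_of_nonneg_right ?_ ha2.le
    have h := abs_log_le_inv_mul_rpow_add hx hs
    rwa [inv_div] at h

/-- Conjunct (b) from the moment form on a measurable accessible set `S ⊆ {φ ≠ 0}`:
`∫⁻_S ofReal (|log ψ² − log φ²| ψ²) ≤ ofReal (C/s) V` whenever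
`∫⁻_S ofReal (((ψ²/φ²)^s + (φ²/ψ²)^s) ψ²) ≤ ofReal C V`. [folklore] -/
theorem logMoment_glue {α : Type*} [MeasurableSpace α] {μ : Measure α} {S : Set α}
    (hS : MeasurableSet S) {ψ φ : α → ℝ} (hφ : ∀ x ∈ S, φ x ≠ 0) {s C : ℝ} (hs : 0 < s)
    {V : ℝ≥0∞}
    (h : ∫⁻ x in S, ENNReal.ofReal (((ψ x ^ 2 / φ x ^ 2) ^ s + (φ x ^ 2 / ψ x ^ 2) ^ s) * ψ x ^ 2) ∂μ
      ≤ ENNReal.ofReal C * V) :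
    ∫⁻ x in S, ENNReal.ofReal (|Real.log (ψ x ^ 2) - Real.log (φ x ^ 2)| * ψ x ^ 2) ∂μ ≤
      ENNReal.ofReal (C / s) * V :=
  calc ∫⁻ x in S, ENNReal.ofReal (|Real.log (ψ x ^ 2) - Real.log (φ x ^ 2)| * ψ x ^ 2) ∂μ
      ≤ ∫⁻ x in S, ENNReal.ofReal s⁻¹ *
          ENNReal.ofReal (((ψ x ^ 2 / φ x ^ 2) ^ s + (φ x ^ 2 / ψ x ^ 2) ^ s) * ψ x ^ 2) ∂μ :=
        setLIntegral_mono' hS fun x hx => logOsc_integrand_le hs (hφ x hx)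
    _ = ENNReal.ofReal s⁻¹ *
          ∫⁻ x in S, ENNReal.ofReal (((ψ x ^ 2 / φ x ^ 2) ^ s + (φ x ^ 2 / ψ x ^ 2) ^ s) * ψ x ^ 2) ∂μ :=
        lintegral_const_mul' _ _ ENNReal.ofReal_ne_top
    _ ≤ ENNReal.ofReal s⁻¹ * (ENNReal.ofReal C * V) := by gcongr
    _ = ENNReal.ofReal (C / s) * V := by
        rw [← mul_assoc, ← ENNReal.ofReal_mul (inv_nonneg.mpr hs.le), inv_mul_eq_div]

/-- The displacement shear `(X, h) ↦ X^h = (x₀ + h, x₁, …, x_n)` is measurable. [folklore] -/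
theorem measurable_displace (n : ℕ) :
    Measurable (fun W : Config (n + 1) × Space => Function.update W.1 0 (W.1 0 + W.2)) := by
  have h1 : Measurable (fun W : Config (n + 1) × Space => (W.1, W.1 0 + W.2)) :=
    measurable_fst.prodMk (((measurable_pi_apply 0).comp measurable_fst).add measurable_snd)
  exact measurable_update'.comp h1

/-- The accessible displaced set `{(X, h) | h ∈ ball 0 r, Ψ₀(X^h) ≠ 0}` is measurable. [folklore] -/
theorem measurableSet_accessible (v : ℝ → ℝ≥0∞) (n : ℕ) (L r : ℝ) :
    MeasurableSet {W : Config (n + 1) × Space | W.2 ∈ Metric.ball (0 : Space) r ∧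
      groundState v (n + 1) L (Function.update W.1 0 (W.1 0 + W.2)) ≠ 0} := by
  have hg : Measurable (fun W : Config (n + 1) × Space =>
      groundState v (n + 1) L (Function.update W.1 0 (W.1 0 + W.2))) :=
    (measurable_groundState v (n + 1) L).comp (measurable_displace n)
  have hB : MeasurableSet {W : Config (n + 1) × Space | W.2 ∈ Metric.ball (0 : Space) r} :=
    measurable_snd measurableSet_ball
  have hZ : MeasurableSet {W : Config (n + 1) × Space |
      groundState v (n + 1) L (Function.update W.1 0 (W.1 0 + W.2)) ≠ 0} :=
    (hg (measurableSet_singleton 0)).compl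
  exact hB.inter hZ

/-! ### Name-keyed handles of the three stub statements — the hypotheses of `OneBodyLogHarnack_of`

The native skeleton audit (`#h21_check_skeleton`) admits a hypothesis of the skeleton theorem only if its head
constant is a registered obligation or is NAMED like a declared stub; `__Registered.stub_X : Prop` is the statement
of `stub_X` under that short name (device of `Cruxes/TiltStability/Lines/birth.lean`,
`Cruxes/LoopsToCrossings/Lines/br-sandwich-diagonal.lean`; the `__` namespace is an implementation detail, so the
audit's stub report resolves each `stub_…` to the sorried theorem above; the gate-reserved `@[stub]` attribute is
not written by a planner). The texts are generated from ONE source string (seat folder `gen_birth.py`), and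
`…_holds` below checks that each handle IS its stub, definitionally. -/
namespace __Registered

/-- Statement of `stub_wallLayer`, keyed by the registered stub name. -/
abbrev stub_wallLayer : Prop :=
      ∀ v : ℝ → ℝ≥0∞, IsRepulsiveFiniteRange v → ∃ ρ₀ : ℝ, 0 < ρ₀ ∧ ∀ ρ : ℝ, 0 < ρ → ρ < ρ₀ →
        ∀ᶠ n : ℕ in Filter.atTop,
          (∫⁻ W in {W : Config (n + 1) × Space | W.2 ∈ Metric.ball (0 : Space) (Real.sqrt (ρ * (scatteringLength v).toReal))⁻¹ ∧
                W.1 0 + W.2 ∉ box (sideLength ρ (n + 1))},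
              ENNReal.ofReal (groundState v (n + 1) (sideLength ρ (n + 1)) W.1 ^ 2)) ≤
            8⁻¹ * MeasureTheory.volume (Metric.ball (0 : Space) (Real.sqrt (ρ * (scatteringLength v).toReal))⁻¹)

/-- Statement of `stub_coreContact`, keyed by the registered stub name. -/
abbrev stub_coreContact : Prop :=
      ∀ v : ℝ → ℝ≥0∞, IsRepulsiveFiniteRange v → ∃ ρ₀ : ℝ, 0 < ρ₀ ∧ ∀ ρ : ℝ, 0 < ρ → ρ < ρ₀ →
        ∀ᶠ n : ℕ in Filter.atTop,
          (∫⁻ W in {W : Config (n + 1) × Space | W.2 ∈ Metric.ball (0 : Space) (Real.sqrt (ρ * (scatteringLength v).toReal))⁻¹ ∧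
                W.1 0 + W.2 ∈ box (sideLength ρ (n + 1)) ∧ groundState v (n + 1) (sideLength ρ (n + 1)) (Function.update W.1 0 (W.1 0 + W.2)) = 0},
              ENNReal.ofReal (groundState v (n + 1) (sideLength ρ (n + 1)) W.1 ^ 2)) ≤
            8⁻¹ * MeasureTheory.volume (Metric.ball (0 : Space) (Real.sqrt (ρ * (scatteringLength v).toReal))⁻¹)

/-- Statement of `stub_logMoment`, keyed by the registered stub name. -/
abbrev stub_logMoment : Prop :=
      ∀ v : ℝ → ℝ≥0∞, IsRepulsiveFiniteRange v → ∃ ρ₀ : ℝ, 0 < ρ₀ ∧ ∀ ρ : ℝ, 0 < ρ → ρ < ρ₀ →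
        ∃ s : ℝ, 0 < s ∧ ∃ C : ℝ, ∀ᶠ n : ℕ in Filter.atTop,
          (∫⁻ W in {W : Config (n + 1) × Space | W.2 ∈ Metric.ball (0 : Space) (Real.sqrt (ρ * (scatteringLength v).toReal))⁻¹ ∧
                groundState v (n + 1) (sideLength ρ (n + 1)) (Function.update W.1 0 (W.1 0 + W.2)) ≠ 0},
              ENNReal.ofReal (((groundState v (n + 1) (sideLength ρ (n + 1)) W.1 ^ 2 / groundState v (n + 1) (sideLength ρ (n + 1)) (Function.update W.1 0 (W.1 0 + W.2)) ^ 2) ^ s +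
                  (groundState v (n + 1) (sideLength ρ (n + 1)) (Function.update W.1 0 (W.1 0 + W.2)) ^ 2 / groundState v (n + 1) (sideLength ρ (n + 1)) W.1 ^ 2) ^ s) * groundState v (n + 1) (sideLength ρ (n + 1)) W.1 ^ 2)) ≤
            ENNReal.ofReal C * MeasureTheory.volume (Metric.ball (0 : Space) (Real.sqrt (ρ * (scatteringLength v).toReal))⁻¹)

/-- consistency: the handle IS the registered stub (definitionally). -/
theorem stub_wallLayer_holds : stub_wallLayer :=
  _root_.Summit.AtomisticToContinuum.BoseEinsteinCondensation.Cruxes.OneBodyLogHarnack.Birth.stub_wallLayer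

/-- consistency: the handle IS the registered stub (definitionally). -/
theorem stub_coreContact_holds : stub_coreContact :=
  _root_.Summit.AtomisticToContinuum.BoseEinsteinCondensation.Cruxes.OneBodyLogHarnack.Birth.stub_coreContact

/-- consistency: the handle IS the registered stub (definitionally). -/
theorem stub_logMoment_holds : stub_logMoment :=
  _root_.Summit.AtomisticToContinuum.BoseEinsteinCondensation.Cruxes.OneBodyLogHarnack.Birth.stub_logMoment

end __Registered

/-! ### The composition: the three stub statements imply the crux, BY NAME (no `sorry` below) -/

/-- **Composition.** `stub_wallLayer → stub_coreContact → stub_logMoment → OneBodyLogHarnack`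
(the route decl, by name; hypotheses are the three stub statements under their registered names):
thresholds `ρ₀ := min`, constant `C := C_M / s`, intersection of the three eventual sets, zeta-reduce the
crux's `let`s; (a) by the union bound `displacedMass_glue`, (b) by `logMoment_glue`. [folklore] -/
theorem OneBodyLogHarnack_of (hW : __Registered.stub_wallLayer) (hC : __Registered.stub_coreContact)
    (hM : __Registered.stub_logMoment) :
    Summit.AtomisticToContinuum.BoseEinsteinCondensation.Theses.BECInsertionVariance.OneBodyLogHarnack := by
  intro v hv
  obtain ⟨ρ₁, hρ₁, h₁⟩ := hW v hv
  obtain ⟨ρ₂, hρ₂, h₂⟩ := hC v hv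
  obtain ⟨ρ₃, hρ₃, h₃⟩ := hM v hv
  refine ⟨min ρ₁ (min ρ₂ ρ₃), lt_min hρ₁ (lt_min hρ₂ hρ₃), fun ρ hρ hρlt => ?_⟩
  have hw := h₁ ρ hρ (lt_of_lt_of_le hρlt (min_le_left _ _))
  have hc := h₂ ρ hρ (lt_of_lt_of_le hρlt ((min_le_right _ _).trans (min_le_left _ _)))
  obtain ⟨s, hs, C, hm⟩ :=
    h₃ ρ hρ (lt_of_lt_of_le hρlt ((min_le_right _ _).trans (min_le_right _ _)))
  refine ⟨C / s, ?_⟩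
  filter_upwards [hw, hc, hm] with n hw hc hm
  dsimp only
  refine ⟨displacedMass_glue hw hc fun W hW => ?_, ?_⟩
  · simp only [Set.mem_union, Set.mem_setOf_eq] at hW ⊢
    by_cases hb : W.1 0 + W.2 ∈ box (sideLength ρ (n + 1))
    · exact Or.inr ⟨hW.1, hb, hW.2⟩
    · exact Or.inl ⟨hW.1, hb⟩
  · exact logMoment_glue (measurableSet_accessible v n _ _) (fun W hW => hW.2) hs hm

/-- The registered stubs themselves compose to the crux (carries `sorryAx` exactly through the three
`stub_*`; becomes the closing proof when they land). -/
theorem OneBodyLogHarnack_of_stubs :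
    Summit.AtomisticToContinuum.BoseEinsteinCondensation.Theses.BECInsertionVariance.OneBodyLogHarnack :=
  OneBodyLogHarnack_of stub_wallLayer stub_coreContact stub_logMoment

end Summit.AtomisticToContinuum.BoseEinsteinCondensation.Cruxes.OneBodyLogHarnack.Birth

end
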